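import Literature.IUT.HodgeTheaters.DiscreteProfiniteConjugatesFreeGroupLemmas
import Mathlib.GroupTheory.Coprod.Basic
import Mathlib.GroupTheory.FreeGroup.NielsenSchreier
import Mathlib.GroupTheory.Schreier
import Mathlib.GroupTheory.Index
import HarnessLib

/-!
# Free products with `ℤ` and free groups of finite rank

Topic `Literature/AlgebraicTopology/FundamentalGroup` (group-theoretic support for the computation of
fundamental groups of punctured surfaces by the Seifert–van Kampen theorem in its HNN / free-product
form, `VanKampen.fundamentalGroupEquivCoprodInt`).  For a group `G` and the infinite cyclic group
`ℤ` (written multiplicatively, `Multiplicative ℤ`):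

* `isFreeOfFiniteRank_coprod_int_iff` — **`G ∗ ℤ` is free of finite rank iff `G` is**: if
  `G ≅ F_n` then `G ∗ ℤ ≅ F_n ∗ F_1 ≅ F_{n+1}`; conversely `G` embeds in `G ∗ ℤ` as a free factor
  (`Monoid.Coprod.inl`), so it is free by the Nielsen–Schreier theorem (Mathlib's
  `subgroupIsFreeOfIsFree`) and finitely generated as a retract (`Monoid.Coprod.fst`), hence free
  of finite rank (`isFreeOfFiniteRank_of_fg`, finite basis);
* `nonempty_mulEquiv_coprod_of_subsingleton_right` — `G ∗ H ≅ G` for a trivial group `H` (the free-product form of van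
  Kampen's theorem with a simply connected piece);
* `IsFreeOfFiniteRank.of_injective_of_finiteIndex` — a group embedding with finite index into a free
  group of finite rank is free of finite rank (Nielsen–Schreier with Schreier's finite generation of
  finite-index subgroups, Mathlib's `Subgroup.fg_of_index_ne_zero`); this is the form in which a
  finite-sheeted covering space of a space with free `π₁` inherits a free `π₁`;
* `IsFreeOfFiniteRank.congr` — invariance under isomorphism across universes.

All statements are proved (isomorphisms are recorded as `Nonempty` statements); no definitions, no
named facts.  Classical group theory (A. Hatcher, *Algebraic Topology* (2002), §1.2 free products and
§1.A Thm. 1A.4 Nielsen–Schreier; R. C. Lyndon, P. E. Schupp, *Combinatorial Group Theory* (1977),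
Ch. I §3; the rank count `F_n ∗ F_m ≅ F_{n+m}` is the universal property).  Written for
the abc-iut cell's geometric column of [AbsTopIII] Prop. 4.2 (i) / Cor. 4.5 (input (α): freeness of
`π₁` of punctured Riemann surfaces); nothing here bears on [IUTchIII] Cor. 3.12.

## References
* A. Hatcher, *Algebraic Topology*, Cambridge Univ. Press (2002), §1.2 (free products of groups),
  §1.A Thm. 1A.4 (Nielsen–Schreier). [HatcherAT2002]
* R. C. Lyndon, P. E. Schupp, *Combinatorial Group Theory*, Springer (1977), Ch. I §3 (Schreier's
  finite generation of finite-index subgroups), Ch. IV §1 (free products) — not cited by key.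
-/

namespace Literature.AlgebraicTopology.FundamentalGroup

open Literature.IUT.HodgeTheaters (IsFreeOfFiniteRank)
open Literature.IUT.HodgeTheaters.FreeOrSurface (isFreeOfFiniteRank_of_fg fg_of_isFreeOfFiniteRank)

universe u v

/-! ### Invariance and the standard free groups -/

/-- `IsFreeOfFiniteRank` is invariant under group isomorphism (universe-polymorphic form of the tree's
`IsFreeOfFiniteRank.of_mulEquiv`). [cite: HatcherAT2002, §1.A (free groups: bases and rank)] -/
theorem IsFreeOfFiniteRank.congr {G : Type u} [Group G] {G' : Type v} [Group G'] (e : G ≃* G')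
    (h : IsFreeOfFiniteRank G) : IsFreeOfFiniteRank G' := by
  obtain ⟨n, ⟨f⟩⟩ := h
  exact ⟨n, ⟨e.symm.trans f⟩⟩

/-- The free group on `Fin n` is free of finite rank. [cite: HatcherAT2002, §1.A (free groups: bases and rank)] -/
theorem isFreeOfFiniteRank_freeGroup_fin (n : ℕ) : IsFreeOfFiniteRank (FreeGroup (Fin n)) :=
  ⟨n, ⟨MulEquiv.refl _⟩⟩

/-- The free group on a finite type is free of finite rank. [cite: HatcherAT2002, §1.A (free groups: bases and rank)] -/
theorem isFreeOfFiniteRank_freeGroup_of_finite (α : Type u) [Finite α] :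
    IsFreeOfFiniteRank (FreeGroup α) := by
  obtain ⟨n, ⟨e⟩⟩ := Finite.exists_equiv_fin α
  exact ⟨n, ⟨FreeGroup.freeGroupCongr e⟩⟩

/-! ### Free products with a trivial group -/

/-- **`G ∗ H ≅ G` for a trivial group `H`** (the free product with the trivial group; used for the
free-product form of van Kampen's theorem when one piece is simply connected). [cite: HatcherAT2002, §1.2 (free products)] -/
theorem nonempty_mulEquiv_coprod_of_subsingleton_right (G : Type u) [Group G] (H : Type v) [Group H]
    [Subsingleton H] : Nonempty (Monoid.Coprod G H ≃* G) :=
  letI : Unique H := uniqueOfSubsingleton 1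
  ⟨(MulEquiv.coprodCongr (MulEquiv.refl G) (MulEquiv.ofUnique : H ≃* PUnit.{v + 1})).trans
    (MulEquiv.coprodPUnit G)⟩

/-! ### Free products with `ℤ` -/

/-- `F_n ∗ ℤ ≅ F_{n+1}` (universal properties of free groups and free products). [cite: HatcherAT2002, §1.2 (free products)] -/
theorem nonempty_freeGroup_fin_coprod_int_mulEquiv (n : ℕ) :
    Nonempty (Monoid.Coprod (FreeGroup (Fin n)) (Multiplicative ℤ) ≃* FreeGroup (Fin (n + 1))) :=
  ⟨((MulEquiv.coprodCongr (MulEquiv.refl _)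
      (MonoidHom.toMulEquiv (zpowersHom (FreeGroup (Fin 1)) (FreeGroup.of 0))
        (FreeGroup.lift fun _ => Multiplicative.ofAdd (1 : ℤ))
        (by ext; simp) (by ext a; fin_cases a; simp))).trans
    ((MonoidHom.toMulEquiv
      (FreeGroup.lift (Sum.elim (fun a => Monoid.Coprod.inl (FreeGroup.of a))
        (fun b => Monoid.Coprod.inr (FreeGroup.of b))))
      (Monoid.Coprod.lift (FreeGroup.map Sum.inl) (FreeGroup.map Sum.inr))
      (by ext x; rcases x with a | b <;> simp)
      (Monoid.Coprod.hom_ext (by ext a; simp) (by ext b; simp))).symm)).trans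
    (FreeGroup.freeGroupCongr finSumFinEquiv)⟩

/-- **If `G` is free of finite rank then so is `G ∗ ℤ`** (`F_n ∗ ℤ ≅ F_{n+1}`).
[cite: HatcherAT2002, §1.2 (free products)] -/
theorem isFreeOfFiniteRank_coprod_int {G : Type u} [Group G] (h : IsFreeOfFiniteRank G) :
    IsFreeOfFiniteRank (Monoid.Coprod G (Multiplicative ℤ)) := by
  obtain ⟨n, ⟨e⟩⟩ := h
  obtain ⟨f⟩ := nonempty_freeGroup_fin_coprod_int_mulEquiv n
  exact ⟨n + 1, ⟨(MulEquiv.coprodCongr e (MulEquiv.refl _)).trans f⟩⟩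

/-- **A free factor of a free group of finite rank is free of finite rank**: if `G ∗ H` is free of
finite rank then so is `G` — `G` embeds by `inl` (Nielsen–Schreier: subgroups of free groups are free)
and is a retract by `fst` (hence finitely generated), and a finitely generated free group has finite
rank. [cite: HatcherAT2002, §1.2 and Thm. 1A.4 (Nielsen–Schreier)] -/
theorem isFreeOfFiniteRank_of_coprod_left {G : Type u} [Group G] {H : Type v} [Group H]
    (h : IsFreeOfFiniteRank (Monoid.Coprod G H)) : IsFreeOfFiniteRank G := by
  obtain ⟨n, ⟨e⟩⟩ := h
  -- `G` is isomorphic to the range of the injective homomorphism `e ∘ inl` into a free group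
  let f : G →* FreeGroup (Fin n) := e.toMonoidHom.comp Monoid.Coprod.inl
  have hf : Function.Injective f := e.injective.comp Monoid.Coprod.inl_injective
  let eG : G ≃* f.range := MonoidHom.ofInjective hf
  haveI : IsFreeGroup f.range := inferInstance
  haveI : IsFreeGroup G := IsFreeGroup.ofMulEquiv eG.symm
  -- `G` is finitely generated: a quotient of the finitely generated group `G ∗ H ≅ F_n`
  haveI : Group.FG (Monoid.Coprod G H) :=
    fg_of_isFreeOfFiniteRank _ ⟨n, ⟨e⟩⟩
  haveI : Group.FG G :=
    Group.fg_of_surjective (f := (Monoid.Coprod.fst : Monoid.Coprod G H →* G))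
      fun g => ⟨Monoid.Coprod.inl g, by simp⟩
  exact isFreeOfFiniteRank_of_fg G

/-- **`G ∗ ℤ` is free of finite rank iff `G` is.** [cite: HatcherAT2002, §1.2 and Thm. 1A.4 (Nielsen–Schreier)] -/
theorem isFreeOfFiniteRank_coprod_int_iff (G : Type u) [Group G] :
    IsFreeOfFiniteRank (Monoid.Coprod G (Multiplicative ℤ)) ↔ IsFreeOfFiniteRank G :=
  ⟨isFreeOfFiniteRank_of_coprod_left, isFreeOfFiniteRank_coprod_int⟩

/-! ### Finite-index embeddings into free groups of finite rank -/

/-- **A group embedding with finite index into a free group of finite rank is free of finite rank**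
(Nielsen–Schreier; Schreier: a finite-index subgroup of a finitely generated group is finitely
generated).  This is how a connected finite-sheeted covering space inherits a free fundamental group of
finite rank from its base. [cite: HatcherAT2002, Thm. 1A.4 (Nielsen–Schreier)] -/
theorem IsFreeOfFiniteRank.of_injective_of_finiteIndex {G : Type u} [Group G] {F : Type v} [Group F]
    (hF : IsFreeOfFiniteRank F) (f : G →* F) (hf : Function.Injective f) (hi : f.range.FiniteIndex) :
    IsFreeOfFiniteRank G := by
  obtain ⟨n, ⟨e⟩⟩ := hF
  haveI : IsFreeGroup F := IsFreeGroup.ofMulEquiv e.symm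
  haveI : IsFreeGroup f.range := inferInstance
  haveI : Group.FG F := fg_of_isFreeOfFiniteRank F ⟨n, ⟨e⟩⟩
  haveI : Group.FG f.range := Subgroup.fg_of_index_ne_zero f.range
  have hr : IsFreeOfFiniteRank f.range := isFreeOfFiniteRank_of_fg f.range
  exact IsFreeOfFiniteRank.congr (MonoidHom.ofInjective hf).symm hr

end Literature.AlgebraicTopology.FundamentalGroup
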